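import Literature.Geometry.Riemannian.GurskyViaclovskyClosednessChartBounds
import Literature.Analysis.FunctionSpaces.CkArzelaAscoli
import HarnessLib

/-!
# Gursky–Viaclovsky closedness: the Arzelà–Ascoli extraction on the closed manifold and the
# reduction of the named fact to uniform chart estimates

Support file (everything PROVED; no definition, no named fact) for the named fact
`Literature.Geometry.Riemannian.gurskyViaclovsky_pathClosed_weighted_four`
(Gursky–Viaclovsky, J. Differential Geom. 63 (2003), Prop. 6 and §5: the solvable set of the
Weyl-weighted `σ₂` continuity path is closed). `GurskyViaclovskyClosednessLimit.lean` reduced the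
fact to a compactness principle with a smooth limit (`pathClosed_of_chartCompactness`: a
subsequence `C²`-convergent in the charts to a `C^∞` function). This file performs the
COMPACTNESS part of that principle inside the tree — the `C^∞` Arzelà–Ascoli theorem in finitely
many charts of the closed manifold, the patching of the chart limits into one smooth function,
and the transport of chart convergence to covariant Hessians at every point of every chart — so
that what remains assumed is exactly the A PRIORI ESTIMATE of the printed proof:

* `tendsto_hessian_and_mvfderiv_of_chart'` — the chart-transport lemma of the Limit file at an
  arbitrary point of a chart domain (centre `c`, point `x ∈ (chartAt c).source`), not only at the
  centre;
* `exists_subseq_smooth_limit_of_chartBounds` — on a compact manifold modelled on `ℝ⁴`, a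
  sequence of smooth functions whose chart representatives `u_k ∘ (chartAt x)⁻¹` obey, on some
  ball around each `chartAt x x`, uniform bounds of every order, has a subsequence converging
  pointwise to a `C^∞` function `v`, with the first and second Fréchet derivatives of the
  representatives converging at every point of finitely many covering charts, hence
  (`tendsto_hessian_and_mvfderiv_of_chart'`) with covariant Hessians and differentials converging
  at every point;
* `pathClosed_of_chartSmoothBounds` — **the named fact follows from uniform local chart bounds of
  all orders** for `C²`-bounded sequences of smooth admissible background solutions at parameters
  `s_k → t`, `s_k ≤ 1` — i.e. from the Evans–Krylov `C^{2,α}` estimate (Gursky–Viaclovsky's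
  Prop. 6; Evans 1982, Krylov 1983, Gilbarg–Trudinger Thm. 17.14) followed by the Schauder
  bootstrap (Gilbarg–Trudinger Lemma 17.16), applied in charts. That estimate is NOT proved here
  (no fully nonlinear elliptic Hölder theory in Mathlib or in the tree) and is not vended as a
  fact; it enters as the inline hypothesis `hbounds`;
* `pathClosed_of_chartHigherBounds` — the same with only the orders `m ≥ 3` of the chart bounds
  assumed: the orders `≤ 2` follow from the fact's covariant bounds
  (`chart_iteratedFDeriv_bounds_le_two`, `GurskyViaclovskyClosednessChartBounds.lean`). What is
  left is thus literally the interior a priori estimate "uniform `C²` bounds (and the equation)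
  give uniform `Cᵐ` bounds for every `m ≥ 3`" for this concave uniformly elliptic equation —
  Evans–Krylov followed by Schauder.

## References

* M. J. Gursky, J. A. Viaclovsky, J. Differential Geom. 63 (2003) 131–154, Prop. 6, §5.
  [GurskyViaclovsky2003]
* D. Gilbarg, N. S. Trudinger, *Elliptic Partial Differential Equations of Second Order* (2001),
  Thm. 17.14, Lemma 17.16, and §6.8 Lemma 6.33. [GilbargTrudinger2001]
* B. O'Neill, *Semi-Riemannian Geometry* (1983), Ch. 3, Lemma 49. [ONeill1983]
-/

noncomputable section

open scoped Manifold ContDiff Topology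
open Set Filter Metric Function

namespace Literature.Geometry.Riemannian.GurskyViaclovskyPath

open Literature.Geometry.Lorentzian (PseudoRiemannianMetric)
open Literature.Geometry.Lorentzian.PseudoRiemannianMetric
open Literature.Geometry.Lorentzian
open Literature.Analysis.FunctionSpaces

section ChartTransport

variable {M : Type*} [TopologicalSpace M] [ChartedSpace (EuclideanSpace ℝ (Fin 4)) M]
  [IsManifold (𝓡 4) ∞ M]
  (g : PseudoRiemannianMetric (𝓡 4) ∞ (EuclideanSpace ℝ (Fin 4)) (TangentSpace (𝓡 4) : M → Type _))
  [g.HasLeviCivita]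

/-- **Chart `C²` convergence at a point of a chart domain gives convergence of the covariant
Hessians and differentials there** — `tendsto_hessian_and_mvfderiv_of_chart` of the Limit file
with the preferred chart at a CENTRE `c` and an arbitrary point `x` of its domain: if the first and
second Fréchet derivatives of `u_k ∘ (chartAt c)⁻¹` at `chartAt c x` converge to those of
`v ∘ (chartAt c)⁻¹`, then `Hess_g u_k(x)(Y,Z) → Hess_g v(x)(Y,Z)` and `du_k(x)(Y) → dv(x)(Y)`
(O'Neill 1983, Lemma 3.49: in the chart `H_{ij} = ∂_i∂_jU − Γ^k_{ij}∂_kU`).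
[cite: ONeill1983, Ch. 3, Lemma 3.49] -/
theorem tendsto_hessian_and_mvfderiv_of_chart' {uk : ℕ → M → ℝ} {v : M → ℝ}
    (huk : ∀ k, ContMDiff (𝓡 4) 𝓘(ℝ) ∞ (uk k)) (hv : ContMDiff (𝓡 4) 𝓘(ℝ) ∞ v) (c : M) {x : M}
    (hxc : x ∈ (chartAt (EuclideanSpace ℝ (Fin 4)) c).source)
    (hD1 : Tendsto
      (fun k ↦ fderiv ℝ (fun y ↦ uk k ((chartAt (EuclideanSpace ℝ (Fin 4)) c).symm y))
        (chartAt (EuclideanSpace ℝ (Fin 4)) c x)) atTop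
      (𝓝 (fderiv ℝ (fun y ↦ v ((chartAt (EuclideanSpace ℝ (Fin 4)) c).symm y))
        (chartAt (EuclideanSpace ℝ (Fin 4)) c x))))
    (hD2 : Tendsto
      (fun k ↦ fderiv ℝ (fderiv ℝ (fun y ↦ uk k ((chartAt (EuclideanSpace ℝ (Fin 4)) c).symm y)))
        (chartAt (EuclideanSpace ℝ (Fin 4)) c x)) atTop
      (𝓝 (fderiv ℝ (fderiv ℝ (fun y ↦ v ((chartAt (EuclideanSpace ℝ (Fin 4)) c).symm y)))
        (chartAt (EuclideanSpace ℝ (Fin 4)) c x)))) :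
    (∀ Y Z : TangentSpace (𝓡 4) x,
        Tendsto (fun k ↦ g.hessian (uk k) x Y Z) atTop (𝓝 (g.hessian v x Y Z))) ∧
      ∀ Y : TangentSpace (𝓡 4) x,
        Tendsto (fun k ↦ mvfderiv (𝓡 4) (uk k) x Y) atTop (𝓝 (mvfderiv (𝓡 4) v x Y)) := by
  -- the inverse chart at `c`
  set U : TopologicalSpace.Opens (EuclideanSpace ℝ (Fin 4)) :=
    ⟨(chartAt (EuclideanSpace ℝ (Fin 4)) c).target,
      (chartAt (EuclideanSpace ℝ (Fin 4)) c).open_target⟩ with hU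
  set Φ : U → M := fun u ↦ (chartAt (EuclideanSpace ℝ (Fin 4)) c).symm u with hΦdef
  have hΦ : ContMDiff 𝓘(ℝ, EuclideanSpace ℝ (Fin 4)) 𝓘(ℝ, EuclideanSpace ℝ (Fin 4)) (∞ + 1) Φ :=
    ChartInverseSelf.contMDiff_symm c
  have hΦ' : ∀ u, Function.Injective
      (mfderiv 𝓘(ℝ, EuclideanSpace ℝ (Fin 4)) 𝓘(ℝ, EuclideanSpace ℝ (Fin 4)) Φ u) :=
    ChartInverseSelf.injective_mfderiv_symm c
  have hdim : Module.finrank ℝ (EuclideanSpace ℝ (Fin 4)) =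
      Module.finrank ℝ (EuclideanSpace ℝ (Fin 4)) := rfl
  have hpb : contMDiff_pullbackBilin 𝓘(ℝ, EuclideanSpace ℝ (Fin 4)) M
      𝓘(ℝ, EuclideanSpace ℝ (Fin 4)) U ∞ := contMDiff_pullbackBilin_holds
  set u₀ : U := ⟨chartAt (EuclideanSpace ℝ (Fin 4)) c x,
    (chartAt (EuclideanSpace ℝ (Fin 4)) c).map_source hxc⟩ with hu₀
  have hx : Φ u₀ = x := (chartAt (EuclideanSpace ℝ (Fin 4)) c).left_inv hxc
  -- the pulled-back metric and its representative
  set gU := g.comap hpb Φ hΦ hΦ' hdim with hgU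
  haveI : gU.HasLeviCivita := gU.hasLeviCivita
  set G : EuclideanSpace ℝ (Fin 4) →
      EuclideanSpace ℝ (Fin 4) →L[ℝ] EuclideanSpace ℝ (Fin 4) →L[ℝ] ℝ :=
    Function.extend (Subtype.val : U → EuclideanSpace ℝ (Fin 4))
      (fun y : U ↦ (gU.val y :
        EuclideanSpace ℝ (Fin 4) →L[ℝ] EuclideanSpace ℝ (Fin 4) →L[ℝ] ℝ)) (fun _ ↦ 0) with hGdef
  have hG : ∀ y : U, gU.val y = G y := fun y ↦ by
    rw [hGdef, Subtype.val_injective.extend_apply]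
  have hGx : DifferentiableAt ℝ G u₀ := OpensChart.differentiableAt_repr hG u₀
  -- the chart representatives are `C²` at `u₀`
  have h2top : (2 : WithTop ℕ∞) ≤ ∞ := WithTop.coe_le_coe.mpr le_top
  have hUk2 : ∀ k, ContDiffAt ℝ 2
      (fun y ↦ uk k ((chartAt (EuclideanSpace ℝ (Fin 4)) c).symm y)) u₀ := fun k ↦
    (ChartInverseSelf.contDiffAt_comp_symm c (huk k) u₀.2).of_le h2top
  have hV2 : ContDiffAt ℝ 2 (fun y ↦ v ((chartAt (EuclideanSpace ℝ (Fin 4)) c).symm y)) u₀ :=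
    (ChartInverseSelf.contDiffAt_comp_symm c hv u₀.2).of_le h2top
  have hUkrep : ∀ k (y : U), (uk k ∘ Φ) y =
      (fun y ↦ uk k ((chartAt (EuclideanSpace ℝ (Fin 4)) c).symm y)) y := fun k y ↦ rfl
  have hVrep : ∀ y : U, (v ∘ Φ) y =
      (fun y ↦ v ((chartAt (EuclideanSpace ℝ (Fin 4)) c).symm y)) y := fun y ↦ rfl
  -- chart Hessians (O'Neill 3.49) and their convergence on chart vectors
  have hHk : ∀ k, gU.hessian (uk k ∘ Φ) u₀ =
      OpensChart.hessianForm gU G (fun y ↦ uk k ((chartAt (EuclideanSpace ℝ (Fin 4)) c).symm y))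
        u₀ := fun k ↦ OpensChart.hessian_eq hG u₀ hGx (hUkrep k) (hUk2 k)
  have hHv : gU.hessian (v ∘ Φ) u₀ =
      OpensChart.hessianForm gU G (fun y ↦ v ((chartAt (EuclideanSpace ℝ (Fin 4)) c).symm y))
        u₀ := OpensChart.hessian_eq hG u₀ hGx hVrep hV2
  have keyH : ∀ Y' Z' : TangentSpace 𝓘(ℝ, EuclideanSpace ℝ (Fin 4)) u₀,
      Tendsto (fun k ↦ gU.hessian (uk k ∘ Φ) u₀ Y' Z') atTop
        (𝓝 (gU.hessian (v ∘ Φ) u₀ Y' Z')) := by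
    intro Y' Z'
    simp only [hHk, hHv]
    refine Tendsto.sub ?_ ?_
    · exact (((continuous_eval_const Z').comp (continuous_eval_const Y')).tendsto _).comp hD2
    · exact ((continuous_eval_const
        (OpensChart.christoffel gU G u₀ Z' Y')).tendsto _).comp hD1
  -- smoothness data at `Φ u₀`
  have h2 : (2 : ℕ∞ω) ≤ ∞ := WithTop.coe_le_coe.mpr le_top
  have hk2 : ∀ k, ContMDiffAt (𝓡 4) 𝓘(ℝ) 2 (uk k) (Φ u₀) := fun k ↦ ((huk k).of_le h2) _
  have hv2' : ContMDiffAt (𝓡 4) 𝓘(ℝ) 2 v (Φ u₀) := (hv.of_le h2) _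
  have hkd : ∀ k, MDifferentiableAt (𝓡 4) 𝓘(ℝ, ℝ) (uk k) (Φ u₀) := fun k ↦
    (hk2 k).mdifferentiableAt (by simp)
  have hvd : MDifferentiableAt (𝓡 4) 𝓘(ℝ, ℝ) v (Φ u₀) := hv2'.mdifferentiableAt (by simp)
  have hΦd : MDifferentiableAt 𝓘(ℝ, EuclideanSpace ℝ (Fin 4)) 𝓘(ℝ, EuclideanSpace ℝ (Fin 4))
      Φ u₀ := ((hΦ.of_le le_self_add) u₀).mdifferentiableAt (by simp)
  set e := mfderivEquivOfInjective (I := 𝓘(ℝ, EuclideanSpace ℝ (Fin 4)))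
    (I' := 𝓘(ℝ, EuclideanSpace ℝ (Fin 4))) Φ u₀ (hΦ' u₀) hdim with he
  -- move the base point to `Φ u₀`
  rw [← hx]
  refine ⟨fun Y Z ↦ ?_, fun Y ↦ ?_⟩
  · obtain ⟨Y', rfl⟩ : ∃ Y', mfderiv 𝓘(ℝ, EuclideanSpace ℝ (Fin 4))
        𝓘(ℝ, EuclideanSpace ℝ (Fin 4)) Φ u₀ Y' = Y :=
      ⟨e.symm Y, mfderiv_mfderivEquivOfInjective_symm _ _ _ _ Y⟩
    obtain ⟨Z', rfl⟩ : ∃ Z', mfderiv 𝓘(ℝ, EuclideanSpace ℝ (Fin 4))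
        𝓘(ℝ, EuclideanSpace ℝ (Fin 4)) Φ u₀ Z' = Z :=
      ⟨e.symm Z, mfderiv_mfderivEquivOfInjective_symm _ _ _ _ Z⟩
    have e1 : ∀ k, g.hessian (uk k) (Φ u₀)
        (mfderiv 𝓘(ℝ, EuclideanSpace ℝ (Fin 4)) 𝓘(ℝ, EuclideanSpace ℝ (Fin 4)) Φ u₀ Y')
        (mfderiv 𝓘(ℝ, EuclideanSpace ℝ (Fin 4)) 𝓘(ℝ, EuclideanSpace ℝ (Fin 4)) Φ u₀ Z') =
        gU.hessian (uk k ∘ Φ) u₀ Y' Z' := fun k ↦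
      (g.hessian_comap_apply hpb hΦ hΦ' hdim (hk2 k) Y' Z').symm
    have e2 : g.hessian v (Φ u₀)
        (mfderiv 𝓘(ℝ, EuclideanSpace ℝ (Fin 4)) 𝓘(ℝ, EuclideanSpace ℝ (Fin 4)) Φ u₀ Y')
        (mfderiv 𝓘(ℝ, EuclideanSpace ℝ (Fin 4)) 𝓘(ℝ, EuclideanSpace ℝ (Fin 4)) Φ u₀ Z') =
        gU.hessian (v ∘ Φ) u₀ Y' Z' :=
      (g.hessian_comap_apply hpb hΦ hΦ' hdim hv2' Y' Z').symm
    rw [e2]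
    exact (keyH Y' Z').congr fun k ↦ (e1 k).symm
  · obtain ⟨Y', rfl⟩ : ∃ Y', mfderiv 𝓘(ℝ, EuclideanSpace ℝ (Fin 4))
        𝓘(ℝ, EuclideanSpace ℝ (Fin 4)) Φ u₀ Y' = Y :=
      ⟨e.symm Y, mfderiv_mfderivEquivOfInjective_symm _ _ _ _ Y⟩
    have e1 : ∀ k, mvfderiv (𝓡 4) (uk k) (Φ u₀)
        (mfderiv 𝓘(ℝ, EuclideanSpace ℝ (Fin 4)) 𝓘(ℝ, EuclideanSpace ℝ (Fin 4)) Φ u₀ Y') =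
        fderiv ℝ (fun y ↦ uk k ((chartAt (EuclideanSpace ℝ (Fin 4)) c).symm y)) u₀ Y' := by
      intro k
      rw [← mvfderiv_comp_apply (hkd k) hΦd,
        OpensChart.mvfderiv_eq u₀ (uk k ∘ Φ) _ (hUkrep k) ((hUk2 k).differentiableAt (by norm_num))]
    have e2 : mvfderiv (𝓡 4) v (Φ u₀)
        (mfderiv 𝓘(ℝ, EuclideanSpace ℝ (Fin 4)) 𝓘(ℝ, EuclideanSpace ℝ (Fin 4)) Φ u₀ Y') =
        fderiv ℝ (fun y ↦ v ((chartAt (EuclideanSpace ℝ (Fin 4)) c).symm y)) u₀ Y' := by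
      rw [← mvfderiv_comp_apply hvd hΦd,
        OpensChart.mvfderiv_eq u₀ (v ∘ Φ) _ hVrep (hV2.differentiableAt (by norm_num))]
    rw [e2]
    refine Tendsto.congr (fun k ↦ (e1 k).symm) ?_
    exact ((continuous_eval_const Y').tendsto _).comp hD1

end ChartTransport

/-! ### The extraction on the closed manifold -/

section Extraction

variable {M : Type*} [TopologicalSpace M] [ChartedSpace (EuclideanSpace ℝ (Fin 4)) M]
  [IsManifold (𝓡 4) ∞ M]

/-- The chart representative `w ∘ (chartAt c)⁻¹` of a smooth function is `C^∞` on the chart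
target. [folklore] -/
theorem contDiffOn_comp_chart_symm {w : M → ℝ} (hw : ContMDiff (𝓡 4) 𝓘(ℝ) ∞ w) (c : M)
    {s : Set (EuclideanSpace ℝ (Fin 4))} (hs : s ⊆ (chartAt (EuclideanSpace ℝ (Fin 4)) c).target) :
    ContDiffOn ℝ ∞ (fun z ↦ w ((chartAt (EuclideanSpace ℝ (Fin 4)) c).symm z)) s :=
  fun _ hz ↦ (ChartInverseSelf.contDiffAt_comp_symm c hw (hs hz)).contDiffWithinAt

/-- **`C^∞` Arzelà–Ascoli on a compact manifold, chart by chart.** Let `M` be a compact manifold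
modelled on `ℝ⁴` and `u_k ∈ C^∞(M)` a sequence whose chart representatives
`u_k ∘ (chartAt x)⁻¹` obey, on some ball `B(chartAt x x, r_x) ⊆ (chartAt x).target` around each
point, uniform bounds of every order. Then along a subsequence `φ` the `u_{φ(k)}` converge
pointwise to a `C^∞` function `v`, and for every Riemannian-type metric `g` with a Levi-Civita
connection the covariant Hessians and the differentials converge at every point:
`Hess_g u_{φ(k)}(x)(Y,Z) → Hess_g v(x)(Y,Z)`, `du_{φ(k)}(x)(Y) → dv(x)(Y)` (finite subcover by the
chart balls, the `C^∞` Arzelà–Ascoli theorem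
`exists_strictMono_tendstoLocallyUniformlyOn_iteratedFDeriv_infty` in each of the finitely many
charts along nested subsequences, patching of the chart limits by
uniqueness of pointwise limits, and `tendsto_hessian_and_mvfderiv_of_chart'`).
[cite: GilbargTrudinger2001, §6.8, Lemma 6.33] -/
theorem exists_subseq_smooth_limit_of_chartBounds [CompactSpace M]
    (g : PseudoRiemannianMetric (𝓡 4) ∞ (EuclideanSpace ℝ (Fin 4))
      (TangentSpace (𝓡 4) : M → Type _)) [g.HasLeviCivita]
    {u : ℕ → M → ℝ} (hu : ∀ k, ContMDiff (𝓡 4) 𝓘(ℝ) ∞ (u k))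
    (hbounds : ∀ x : M, ∃ r : ℝ, 0 < r ∧
      ball (chartAt (EuclideanSpace ℝ (Fin 4)) x x) r ⊆
        (chartAt (EuclideanSpace ℝ (Fin 4)) x).target ∧
      ∀ m : ℕ, ∃ B : ℝ, ∀ k, ∀ y ∈ ball (chartAt (EuclideanSpace ℝ (Fin 4)) x x) r,
        ‖iteratedFDeriv ℝ m (fun z ↦ u k ((chartAt (EuclideanSpace ℝ (Fin 4)) x).symm z)) y‖
          ≤ B) :
    ∃ (v : M → ℝ) (φ : ℕ → ℕ), StrictMono φ ∧ ContMDiff (𝓡 4) 𝓘(ℝ) ∞ v ∧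
      (∀ x, Tendsto (fun k ↦ u (φ k) x) atTop (𝓝 (v x))) ∧
      ∀ x : M,
        (∀ Y Z : TangentSpace (𝓡 4) x,
          Tendsto (fun k ↦ g.hessian (u (φ k)) x Y Z) atTop (𝓝 (g.hessian v x Y Z))) ∧
        ∀ Y : TangentSpace (𝓡 4) x,
          Tendsto (fun k ↦ mvfderiv (𝓡 4) (u (φ k)) x Y) atTop (𝓝 (mvfderiv (𝓡 4) v x Y)) := by
  classical
  choose r hr hrT hB using hbounds
  -- the chart neighbourhoods and a finite subcover
  let V : M → Set M := fun c ↦ (chartAt (EuclideanSpace ℝ (Fin 4)) c).source ∩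
    chartAt (EuclideanSpace ℝ (Fin 4)) c ⁻¹' ball (chartAt (EuclideanSpace ℝ (Fin 4)) c c) (r c)
  have hVo : ∀ c, IsOpen (V c) := fun c ↦
    (chartAt (EuclideanSpace ℝ (Fin 4)) c).continuousOn.isOpen_inter_preimage
      (chartAt (EuclideanSpace ℝ (Fin 4)) c).open_source isOpen_ball
  have hcV : ∀ c, c ∈ V c := fun c ↦ ⟨mem_chart_source _ c, mem_ball_self (hr c)⟩
  obtain ⟨T, hT⟩ : ∃ T : Finset M, (univ : Set M) ⊆ ⋃ c ∈ T, V c :=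
    isCompact_univ.elim_finite_subcover V hVo fun x _ ↦ mem_iUnion.2 ⟨x, hcV x⟩
  -- chart representatives
  let rep : M → (M → ℝ) → EuclideanSpace ℝ (Fin 4) → ℝ := fun c w z ↦
    w ((chartAt (EuclideanSpace ℝ (Fin 4)) c).symm z)
  -- Step 1: one subsequence converging in `C^∞` of every chart ball of the subcover
  let P : ↥T → (ℕ → ℕ) → Prop := fun c φ ↦ ∃ G : EuclideanSpace ℝ (Fin 4) → ℝ,
    ContDiffOn ℝ ∞ G (ball (chartAt (EuclideanSpace ℝ (Fin 4)) (c : M) c) (r c)) ∧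
      ∀ m : ℕ, TendstoLocallyUniformlyOn (fun j ↦ iteratedFDeriv ℝ m (rep c (u (φ j))))
        (iteratedFDeriv ℝ m G) atTop (ball (chartAt (EuclideanSpace ℝ (Fin 4)) (c : M) c) (r c))
  have hsub : ∀ c (φ φ' : ℕ → ℕ), (∃ ρ : ℕ → ℕ, StrictMono ρ ∧ ∀ᶠ n in atTop, φ' n = φ (ρ n)) →
      P c φ → P c φ' := by
    rintro c φ φ' ⟨ρ, hρ, hρeq⟩ ⟨G, hG, hlim⟩
    exact ⟨G, hG, fun m ↦ tendstoLocallyUniformlyOn_of_eventually_eq_comp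
      (G := fun j ↦ iteratedFDeriv ℝ m (rep c (u j))) hρ hρeq (hlim m)⟩
  have hex : ∀ c (φ : ℕ → ℕ), StrictMono φ → ∃ ψ : ℕ → ℕ, StrictMono ψ ∧ P c (φ ∘ ψ) := by
    intro c φ _
    obtain ⟨G, ψ, hψ, hG, hlim⟩ :=
      exists_strictMono_tendstoLocallyUniformlyOn_iteratedFDeriv_infty
        (f := fun j ↦ rep c (u (φ j))) isOpen_ball
        (fun j ↦ contDiffOn_comp_chart_symm (hu (φ j)) (c : M) (hrT c))
        (fun m ↦ by
          obtain ⟨B, hB'⟩ := hB (c : M) m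
          exact ⟨B, fun j y hy ↦ hB' (φ j) y hy⟩)
    exact ⟨ψ, hψ, G, hG, hlim⟩
  obtain ⟨φ, hφ, hP⟩ := exists_strictMono_forall_of_extraction' hsub hex
  choose G hGs hGlim using hP
  -- Step 2: pointwise limits and the patched limit function
  have hptlim : ∀ (c : ↥T) (x : M), x ∈ V c →
      Tendsto (fun j ↦ u (φ j) x) atTop
        (𝓝 (G c (chartAt (EuclideanSpace ℝ (Fin 4)) (c : M) x))) := by
    intro c x hx
    have hxb : chartAt (EuclideanSpace ℝ (Fin 4)) (c : M) x ∈
        ball (chartAt (EuclideanSpace ℝ (Fin 4)) (c : M) c) (r c) := hx.2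
    have h0 := tendsto_of_tendstoLocallyUniformlyOn_iteratedFDeriv_zero
      (f := fun j ↦ rep c (u j)) (hGlim c 0) hxb
    have h0' : Tendsto (fun j ↦ rep c (u (φ j)) (chartAt (EuclideanSpace ℝ (Fin 4)) (c : M) x))
        atTop (𝓝 (G c (chartAt (EuclideanSpace ℝ (Fin 4)) (c : M) x))) := by
      have hGeq : G c (chartAt (EuclideanSpace ℝ (Fin 4)) (c : M) x) =
          iteratedFDeriv ℝ 0 (G c) (chartAt (EuclideanSpace ℝ (Fin 4)) (c : M) x) 0 := by
        rw [iteratedFDeriv_zero_apply]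
      rw [hGeq]
      exact h0
    refine h0'.congr fun j ↦ ?_
    show u (φ j) ((chartAt (EuclideanSpace ℝ (Fin 4)) (c : M)).symm
      (chartAt (EuclideanSpace ℝ (Fin 4)) (c : M) x)) = u (φ j) x
    rw [(chartAt (EuclideanSpace ℝ (Fin 4)) (c : M)).left_inv hx.1]
  have hmem : ∀ x : M, ∃ c : ↥T, x ∈ V c := fun x ↦ by
    have hx := hT (mem_univ x)
    simp only [mem_iUnion] at hx
    obtain ⟨c, hc, hxc⟩ := hx
    exact ⟨⟨c, hc⟩, hxc⟩
  choose ι hι using hmem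
  let v : M → ℝ := fun x ↦ G (ι x) (chartAt (EuclideanSpace ℝ (Fin 4)) (ι x : M) x)
  have hvlim : ∀ x, Tendsto (fun j ↦ u (φ j) x) atTop (𝓝 (v x)) := fun x ↦ hptlim (ι x) x (hι x)
  have hveq : ∀ (c : ↥T) (x : M), x ∈ V c →
      v x = G c (chartAt (EuclideanSpace ℝ (Fin 4)) (c : M) x) := fun c x hx ↦
    tendsto_nhds_unique (hvlim x) (hptlim c x hx)
  -- Step 3: smoothness of the limit
  have hv : ContMDiff (𝓡 4) 𝓘(ℝ) ∞ v := by
    intro x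
    have hx := hι x
    have h1 : ContMDiffOn (𝓡 4) 𝓘(ℝ) ∞
        (fun y ↦ G (ι x) (chartAt (EuclideanSpace ℝ (Fin 4)) (ι x : M) y)) (V (ι x)) := by
      have hG' : ContMDiffOn 𝓘(ℝ, EuclideanSpace ℝ (Fin 4)) 𝓘(ℝ) ∞ (G (ι x))
          (ball (chartAt (EuclideanSpace ℝ (Fin 4)) (ι x : M) (ι x)) (r (ι x))) :=
        (hGs (ι x)).contMDiffOn
      have hch : ContMDiffOn (𝓡 4) 𝓘(ℝ, EuclideanSpace ℝ (Fin 4)) ∞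
          (chartAt (EuclideanSpace ℝ (Fin 4)) (ι x : M))
          (chartAt (EuclideanSpace ℝ (Fin 4)) (ι x : M)).source := contMDiffOn_chart
      exact hG'.comp (hch.mono inter_subset_left) fun y hy ↦ hy.2
    have h2 : ContMDiffAt (𝓡 4) 𝓘(ℝ) ∞
        (fun y ↦ G (ι x) (chartAt (EuclideanSpace ℝ (Fin 4)) (ι x : M) y)) x :=
      h1.contMDiffAt ((hVo _).mem_nhds hx)
    refine h2.congr_of_eventuallyEq ?_
    filter_upwards [(hVo _).mem_nhds hx] with y hy
    exact hveq (ι x) y hy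
  refine ⟨v, φ, hφ, hv, hvlim, fun x ↦ ?_⟩
  -- Step 4: chart derivatives at `x` in the chart centred at `ι x`, and transport
  set c : ↥T := ι x with hc
  have hx : x ∈ V c := hι x
  set y : EuclideanSpace ℝ (Fin 4) := chartAt (EuclideanSpace ℝ (Fin 4)) (c : M) x with hy
  have hyb : y ∈ ball (chartAt (EuclideanSpace ℝ (Fin 4)) (c : M) c) (r c) := hx.2
  have hrepv : (fun z ↦ v ((chartAt (EuclideanSpace ℝ (Fin 4)) (c : M)).symm z)) =ᶠ[𝓝 y]
      G c := by
    filter_upwards [isOpen_ball.mem_nhds hyb] with z hz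
    have hzT : z ∈ (chartAt (EuclideanSpace ℝ (Fin 4)) (c : M)).target := hrT c hz
    have hz' : (chartAt (EuclideanSpace ℝ (Fin 4)) (c : M)).symm z ∈ V c := by
      refine ⟨(chartAt (EuclideanSpace ℝ (Fin 4)) (c : M)).map_target hzT, ?_⟩
      rw [mem_preimage, (chartAt (EuclideanSpace ℝ (Fin 4)) (c : M)).right_inv hzT]
      exact hz
    rw [hveq c _ hz', (chartAt (EuclideanSpace ℝ (Fin 4)) (c : M)).right_inv hzT]
  have key0 := tendsto_fderiv_of_tendstoLocallyUniformlyOn_iteratedFDeriv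
    (f := fun j ↦ rep c (u j)) (g := G c) (φ := φ) (fun i _ ↦ hGlim c i) hyb
  have hD1 : Tendsto (fun j ↦ fderiv ℝ (rep c (u (φ j))) y) atTop
      (𝓝 (fderiv ℝ (fun z ↦ v ((chartAt (EuclideanSpace ℝ (Fin 4)) (c : M)).symm z)) y)) := by
    rw [hrepv.fderiv_eq]
    exact key0.2.1
  have hD2 : Tendsto (fun j ↦ fderiv ℝ (fderiv ℝ (rep c (u (φ j)))) y) atTop
      (𝓝 (fderiv ℝ (fderiv ℝ
        (fun z ↦ v ((chartAt (EuclideanSpace ℝ (Fin 4)) (c : M)).symm z))) y)) := by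
    rw [hrepv.fderiv.fderiv_eq]
    exact key0.2.2
  exact tendsto_hessian_and_mvfderiv_of_chart' g (uk := fun j ↦ u (φ j)) (fun j ↦ hu (φ j)) hv
    (c : M) hx.1 hD1 hD2

end Extraction

/-! ### The named fact from uniform chart estimates -/

section Reduction

/-- **`gurskyViaclovsky_pathClosed_weighted_four` follows from uniform local chart bounds of
all orders** (the a priori estimate of the printed proof, assumed inline). Hypothesis `hbounds`:
on a closed Riemannian `4`-manifold, for every `C²`-bounded sequence of smooth admissible
background solutions `u_k` at parameters `s_k → t`, `s_k ≤ 1`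
(`backgroundPathOperator g s_k (−u_k) = q e^{4u_k}`, `backgroundScalar g (−u_k) > 0`,
`|u_k|, |∇u_k|²_g, |∇²u_k|²_g ≤ C`), every point has a chart ball on which the representatives
`u_k ∘ (chartAt x)⁻¹` are bounded in every `Cᵐ` uniformly in `k` — Gursky–Viaclovsky's Prop. 6
("the `C²` estimate implies uniform ellipticity, and the `C^{2,α}` estimate then follows from the
work of [Krylov] and [Evans]"; Gilbarg–Trudinger Thm. 17.14) followed by the Schauder bootstrap
("classical elliptic regularity theory", §5; Gilbarg–Trudinger Lemma 17.16). NOT proved in the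
tree (no fully nonlinear elliptic Hölder theory) and not vended as a fact. Conclusion: the named
fact — by the chart-wise `C^∞` Arzelà–Ascoli extraction `exists_subseq_smooth_limit_of_chartBounds`
and the assembly `pathClosed_of_frameCompactness` of the Limit file (limit equation, admissibility
of the limit by the `Γ₂⁺`-cone step, `solvable_of_background`).
[cite: GurskyViaclovsky2003, Prop. 6 and §5 (proof of Thm. 1)] -/
theorem pathClosed_of_chartSmoothBounds
    (hbounds : ∀ (M : Type) [TopologicalSpace M] [T2Space M] [SecondCountableTopology M]
      [ChartedSpace (EuclideanSpace ℝ (Fin 4)) M] [IsManifold (𝓡 4) ∞ M]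
      [CompactSpace M] [ConnectedSpace M]
      (g : PseudoRiemannianMetric (𝓡 4) ∞ (EuclideanSpace ℝ (Fin 4))
        (TangentSpace (𝓡 4) : M → Type _))
      [g.HasLeviCivita], g.IsRiemannian →
      ∀ (q : M → ℝ) (C : ℝ), ContMDiff (𝓡 4) 𝓘(ℝ) ∞ q → (∀ x, 0 < q x) →
      ∀ (s : ℕ → ℝ) (t : ℝ), Tendsto s atTop (𝓝 t) → (∀ k, s k ≤ 1) →
      ∀ (u : ℕ → M → ℝ), (∀ k, ContMDiff (𝓡 4) 𝓘(ℝ) ∞ (u k)) →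
        (∀ k x, backgroundPathOperator g (s k) (fun y ↦ -u k y) x =
          q x * Real.exp (-4 * (-u k x))) →
        (∀ k x, 0 < backgroundScalar g (fun y ↦ -u k y) x) →
        (∀ k x, |u k x| ≤ C ∧ g.gradSq (u k) x ≤ C ∧ g.normSq x (g.hessian (u k) x) ≤ C) →
        ∀ x : M, ∃ r : ℝ, 0 < r ∧
          ball (chartAt (EuclideanSpace ℝ (Fin 4)) x x) r ⊆
            (chartAt (EuclideanSpace ℝ (Fin 4)) x).target ∧
          ∀ m : ℕ, ∃ B : ℝ, ∀ k, ∀ y ∈ ball (chartAt (EuclideanSpace ℝ (Fin 4)) x x) r,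
            ‖iteratedFDeriv ℝ m
                (fun z ↦ u k ((chartAt (EuclideanSpace ℝ (Fin 4)) x).symm z)) y‖ ≤ B) :
    gurskyViaclovsky_pathClosed_weighted_four := by
  refine pathClosed_of_frameCompactness fun M _ _ _ _ _ _ _ g _ hg q C hq hq0 s t hs hs1 u hu heq
    hpos hbd ↦ ?_
  obtain ⟨v, φ, hφ, hv, hlim, hder⟩ := exists_subseq_smooth_limit_of_chartBounds g hu
    (hbounds M g hg q C hq hq0 s t hs hs1 u hu heq hpos hbd)
  exact ⟨v, φ, hφ, hv, hlim, fun x e _ ↦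
    ⟨fun a b ↦ (hder x).1 (e a) (e b), fun a ↦ (hder x).2 (e a)⟩⟩

/-- **`gurskyViaclovsky_pathClosed_weighted_four` follows from uniform local chart bounds of the
orders `m ≥ 3` alone** — the orders `≤ 2` being consequences of the covariant bounds in the
hypothesis of the fact (`chart_iteratedFDeriv_bounds_le_two`). Hypothesis `hbounds`: for every
`C²`-bounded sequence of smooth admissible background solutions at parameters `s_k → t`,
`s_k ≤ 1`, every point has a chart ball on which, for each `m ≥ 3`, the `m`-th derivatives of
the representatives `u_k ∘ (chartAt x)⁻¹` are bounded uniformly in `k` — the interior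
Evans–Krylov `C^{2,α}` estimate for concave uniformly elliptic equations (Gursky–Viaclovsky
Prop. 6; Gilbarg–Trudinger Thm. 17.14) followed by the Schauder bootstrap (Gilbarg–Trudinger
Lemma 17.16). NOT proved in the tree and not vended as a fact.
[cite: GurskyViaclovsky2003, Prop. 6 and §5 (proof of Thm. 1)] -/
theorem pathClosed_of_chartHigherBounds
    (hbounds : ∀ (M : Type) [TopologicalSpace M] [T2Space M] [SecondCountableTopology M]
      [ChartedSpace (EuclideanSpace ℝ (Fin 4)) M] [IsManifold (𝓡 4) ∞ M]
      [CompactSpace M] [ConnectedSpace M]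
      (g : PseudoRiemannianMetric (𝓡 4) ∞ (EuclideanSpace ℝ (Fin 4))
        (TangentSpace (𝓡 4) : M → Type _))
      [g.HasLeviCivita], g.IsRiemannian →
      ∀ (q : M → ℝ) (C : ℝ), ContMDiff (𝓡 4) 𝓘(ℝ) ∞ q → (∀ x, 0 < q x) →
      ∀ (s : ℕ → ℝ) (t : ℝ), Tendsto s atTop (𝓝 t) → (∀ k, s k ≤ 1) →
      ∀ (u : ℕ → M → ℝ), (∀ k, ContMDiff (𝓡 4) 𝓘(ℝ) ∞ (u k)) →
        (∀ k x, backgroundPathOperator g (s k) (fun y ↦ -u k y) x =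
          q x * Real.exp (-4 * (-u k x))) →
        (∀ k x, 0 < backgroundScalar g (fun y ↦ -u k y) x) →
        (∀ k x, |u k x| ≤ C ∧ g.gradSq (u k) x ≤ C ∧ g.normSq x (g.hessian (u k) x) ≤ C) →
        ∀ x : M, ∃ r : ℝ, 0 < r ∧
          ball (chartAt (EuclideanSpace ℝ (Fin 4)) x x) r ⊆
            (chartAt (EuclideanSpace ℝ (Fin 4)) x).target ∧
          ∀ m : ℕ, 3 ≤ m → ∃ B : ℝ, ∀ k, ∀ y ∈ ball (chartAt (EuclideanSpace ℝ (Fin 4)) x x) r,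
            ‖iteratedFDeriv ℝ m
                (fun z ↦ u k ((chartAt (EuclideanSpace ℝ (Fin 4)) x).symm z)) y‖ ≤ B) :
    gurskyViaclovsky_pathClosed_weighted_four := by
  refine pathClosed_of_chartSmoothBounds fun M _ _ _ _ _ _ _ g _ hg q C hq hq0 s t hs hs1 u hu heq
    hpos hbd x ↦ ?_
  obtain ⟨r₁, hr₁, hT₁, h₁⟩ := hbounds M g hg q C hq hq0 s t hs hs1 u hu heq hpos hbd x
  obtain ⟨r₂, hr₂, -, h₂⟩ := chart_iteratedFDeriv_bounds_le_two g hg hu hbd x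
  refine ⟨min r₁ r₂, lt_min hr₁ hr₂, (ball_subset_ball (min_le_left _ _)).trans hT₁, fun m ↦ ?_⟩
  rcases le_or_gt m 2 with hm | hm
  · obtain ⟨B, hB⟩ := h₂ m hm
    exact ⟨B, fun k y hy ↦ hB k y (ball_subset_ball (min_le_right _ _) hy)⟩
  · obtain ⟨B, hB⟩ := h₁ m (by omega)
    exact ⟨B, fun k y hy ↦ hB k y (ball_subset_ball (min_le_left _ _) hy)⟩

end Reduction

end Literature.Geometry.Riemannian.GurskyViaclovskyPath

end
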